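import Mathlib
import HarnessLib
import Literature.MathematicalPhysics.QuantumLattice.GroundStateEnclosureCertificate
import Literature.Analysis.OperatorTheory.SchurComplementCount

/-!
# From block inertia certificates in a real orthogonal frame to the complement-gap hypothesis

Soundness edges (finite-dimensional linear algebra, PROVED, no definitions) between

* the shape a symmetry-blocked exact-diagonalisation certificate produces — for each symmetry block `b`
  of a sector `K` presented in a REAL frame (columns of `Φ`: orbit sums / symmetry-adapted vectors with
  real coefficients; Gram matrix `G = Φᴴ Φ` and compression `M = Φᴴ A Φ` real, `G` typically diagonal),
  the statement "`yᵀ (M_b − β G_b) y ≥ 0` for every real `y` with `c_j ⬝ y = 0` (`j < k_b`)", obtained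
  from ONE verified positive semidefiniteness of `M_b − β G_b + Σ_j t_j c_j c_jᵀ` (possibly through a
  Schur-complement / polynomially filtered certificate,
  `Literature.Analysis.OperatorTheory.fromBlocks_dotProduct_nonneg_of_schur_poly_cert` and its pencil form);
* and the hypothesis a multiplet ground-state enclosure consumes — "`Re ⟨v, A v⟩ ≥ β ‖v‖²` for every
  `v ∈ K` orthogonal to the certified approximate ground vectors `φ_1 … φ_k`" — when the constraint
  vectors are chosen EXACTLY as `c_j = Φᴴ φ_j` (`= G f_j` if `φ_j = Φ f_j`): no perturbation / subspace-angle
  argument is needed, the orthogonality conditions are transported verbatim.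

Contents: `re_star_dotProduct_map_mulVec` (a real matrix's Hermitian form splits into the real forms of
the real and imaginary parts, Horn–Johnson (2013) proof of Thm 4.1.10), `form_ge_on_ker_of_rank_modified`
(`K + Σ t_j c_j c_jᵀ ⪰ 0 ⇒ K ⪰ 0` on `{c_j ⬝ y = 0}`), `form_ge_on_ker_of_blocks` (block-diagonal sum of
per-block statements), and the glue `re_form_ge_on_orthogonal_of_real_frame_certificate`.
Every hypothesis explicit; no `sorry`.
-/

namespace Literature.MathematicalPhysics.QuantumLattice

namespace TempleKato

open Matrix
open scoped Matrix ComplexOrder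

variable {ι κ : Type*} [Fintype ι] [Fintype κ]

/-! ### Real frames: splitting a Hermitian form into two real quadratic forms -/

/-- For a REAL matrix `M` and a complex vector `y = yʳ + i yⁱ`:
`Re (yᴴ M y) = (yʳ)ᵀ M yʳ + (yⁱ)ᵀ M yⁱ` (the cross terms are purely imaginary). Horn–Johnson (2013),
proof of Thm 4.1.10 (`z*Az = xᵀAx + yᵀAy + i(xᵀAy − yᵀAx)`). [cite: HornJohnson2013, Thm 4.1.10] -/
theorem re_star_dotProduct_map_mulVec (M : Matrix κ κ ℝ) (y : κ → ℂ) :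
    (star y ⬝ᵥ (M.map ((↑) : ℝ → ℂ)) *ᵥ y).re =
      (fun a => (y a).re) ⬝ᵥ M *ᵥ (fun a => (y a).re) +
        (fun a => (y a).im) ⬝ᵥ M *ᵥ (fun a => (y a).im) := by
  simp only [dotProduct, mulVec, Matrix.map_apply, Pi.star_apply, Complex.re_sum, Complex.mul_re,
    Complex.mul_im, Complex.star_def, Complex.conj_re, Complex.conj_im, Complex.ofReal_re,
    Complex.ofReal_im, Finset.mul_sum, ← Finset.sum_add_distrib]
  refine Finset.sum_congr rfl fun a _ => Finset.sum_congr rfl fun b _ => ?_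
  ring

/-- A real constraint vector annihilates a complex vector iff it annihilates its real and imaginary
parts: `Σ c_a y_a = 0 ⇒ c ⬝ yʳ = 0 ∧ c ⬝ yⁱ = 0`. [cite: HornJohnson2013, Thm 4.1.10] -/
theorem dotProduct_re_im_eq_zero_of_real (c : κ → ℝ) (y : κ → ℂ)
    (h : star (fun a => (c a : ℂ)) ⬝ᵥ y = 0) :
    c ⬝ᵥ (fun a => (y a).re) = 0 ∧ c ⬝ᵥ (fun a => (y a).im) = 0 := by
  have hre := congrArg Complex.re h
  have him := congrArg Complex.im h
  simp only [dotProduct, Pi.star_apply, Complex.star_def, Complex.conj_ofReal, Complex.re_sum,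
    Complex.im_sum, Complex.re_ofReal_mul, Complex.im_ofReal_mul, Complex.zero_re, Complex.zero_im]
    at hre him
  exact ⟨hre, him⟩

omit [Fintype ι] in
/-- Orthogonality to `φ` of a frame vector `Φ y` is a linear constraint on the coordinates with the
EXACT constraint vector `Φᴴ φ`: `⟨φ, Φ y⟩ = ⟨Φᴴ φ, y⟩`. [folklore] -/
private theorem star_dotProduct_frame_mulVec [Fintype ι] (Φ : Matrix ι κ ℂ) (φ : ι → ℂ) (y : κ → ℂ) :
    star φ ⬝ᵥ (Φ *ᵥ y) = star (Φᴴ *ᵥ φ) ⬝ᵥ y := by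
  rw [dotProduct_mulVec, star_mulVec, conjTranspose_conjTranspose]

/-! ### Deflation and block bookkeeping on the real side -/

/-- **Rank-`k`-modified positivity ⇒ positivity on the kernel of the constraints.** If
`yᵀ (M − β G + Σ_j t_j c_j c_jᵀ) y ≥ 0` for all real `y` (one verified `LDLᵀ` / Cholesky, or a Schur /
polynomially filtered certificate for this explicit matrix), then `β yᵀ G y ≤ yᵀ M y` whenever
`c_j ⬝ y = 0` for all `j` (any real `t_j`). [cite: Haynsworth1968, Thm 1] -/
theorem form_ge_on_ker_of_rank_modified {o : Type*} [Fintype o] (M G : Matrix o o ℝ) (β : ℝ) {k : ℕ}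
    (t : Fin k → ℝ) (c : Fin k → o → ℝ)
    (hpsd : ∀ v : o → ℝ, 0 ≤ v ⬝ᵥ (M - β • G + ∑ j, t j • vecMulVec (c j) (c j)) *ᵥ v)
    (y : o → ℝ) (hy : ∀ j, c j ⬝ᵥ y = 0) : β * (y ⬝ᵥ G *ᵥ y) ≤ y ⬝ᵥ M *ᵥ y := by
  have h := hpsd y
  rw [add_mulVec, dotProduct_add,
    Literature.Analysis.OperatorTheory.dotProduct_sum_vecMulVec_mulVec_eq_zero t c y hy, add_zero,
    sub_mulVec, dotProduct_sub, smul_mulVec, dotProduct_smul, smul_eq_mul] at h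
  linarith

/-- The same with the modified matrix presented in `2 × 2` block form (free block first, pinned block
second, as produced by `fromBlocks_dotProduct_nonneg_of_schur_poly_cert` and its pencil variant with NO
residual deflation vectors): `M − β G + Σ_j t_j c_j c_jᵀ = [[A′, B′], [B′ᵀ, D′]]` and
`(x ⊕ y)ᵀ [[A′, B′], [B′ᵀ, D′]] (x ⊕ y) ≥ 0` for all `x, y`. [cite: Haynsworth1968, Thm 1] -/
theorem form_ge_on_ker_of_rank_modified_fromBlocks {m n : Type*} [Fintype m] [Fintype n]
    (M G : Matrix (m ⊕ n) (m ⊕ n) ℝ) (β : ℝ) {k : ℕ} (t : Fin k → ℝ) (c : Fin k → m ⊕ n → ℝ)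
    (A' : Matrix m m ℝ) (B' : Matrix m n ℝ) (D' : Matrix n n ℝ)
    (hblocks : M - β • G + ∑ j, t j • vecMulVec (c j) (c j) = fromBlocks A' B' B'ᵀ D')
    (hpsd : ∀ (x : m → ℝ) (y : n → ℝ), 0 ≤ (Sum.elim x y) ⬝ᵥ (fromBlocks A' B' B'ᵀ D' *ᵥ Sum.elim x y))
    (y : m ⊕ n → ℝ) (hy : ∀ j, c j ⬝ᵥ y = 0) : β * (y ⬝ᵥ G *ᵥ y) ≤ y ⬝ᵥ M *ᵥ y := by
  refine form_ge_on_ker_of_rank_modified M G β t c (fun v => ?_) y hy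
  rw [hblocks, ← Sum.elim_comp_inl_inr v]
  exact hpsd _ _

/-- **Block-diagonal bookkeeping.** Let the coordinates be labelled by blocks (`blk : o → B`), `M` and `G`
vanish across blocks, and each constraint vector `c_j` be supported in one block. If for every block
`b` the inequality `β zᵀ G z ≤ zᵀ M z` holds for every `z` supported in `b` and annihilated by all
constraints, then it holds for every `y` annihilated by all constraints (sum over blocks of the
restrictions `z_b = 1_b · y`). (Haynsworth inertia additivity.) [cite: Haynsworth1968, Thm 1] -/
theorem form_ge_on_ker_of_blocks {o B : Type*} [Fintype o] [DecidableEq B] (blk : o → B)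
    (M G : Matrix o o ℝ) (β : ℝ) {k : ℕ} (c : Fin k → o → ℝ)
    (hM : ∀ a a', blk a ≠ blk a' → M a a' = 0) (hG : ∀ a a', blk a ≠ blk a' → G a a' = 0)
    (hc : ∀ j, ∃ b, ∀ a, blk a ≠ b → c j a = 0)
    (hblk : ∀ (b : B) (z : o → ℝ), (∀ a, blk a ≠ b → z a = 0) → (∀ j, c j ⬝ᵥ z = 0) →
      β * (z ⬝ᵥ G *ᵥ z) ≤ z ⬝ᵥ M *ᵥ z)
    (y : o → ℝ) (hy : ∀ j, c j ⬝ᵥ y = 0) : β * (y ⬝ᵥ G *ᵥ y) ≤ y ⬝ᵥ M *ᵥ y := by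
  classical
  -- restriction of `y` to block `b`
  set z : B → o → ℝ := fun b a => if blk a = b then y a else 0 with hz
  have hzsupp : ∀ b a, blk a ≠ b → z b a = 0 := fun b a h => by simp [hz, h]
  -- a block-diagonal form is the sum of its block restrictions (over the blocks that occur)
  have hsplit : ∀ N : Matrix o o ℝ, (∀ a a', blk a ≠ blk a' → N a a' = 0) →
      y ⬝ᵥ N *ᵥ y = ∑ b ∈ (Finset.univ : Finset o).image blk, z b ⬝ᵥ N *ᵥ z b := by
    intro N hN
    have hterm : ∀ a a', y a * (N a a' * y a') =
        ∑ b ∈ (Finset.univ : Finset o).image blk, z b a * (N a a' * z b a') := by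
      intro a a'
      by_cases hab : blk a = blk a'
      · rw [Finset.sum_eq_single (blk a)]
        · simp [hz, hab]
        · intro b _ hb
          have : z b a = 0 := hzsupp b a (Ne.symm hb)
          rw [this, zero_mul]
        · intro h
          exact absurd (Finset.mem_image_of_mem blk (Finset.mem_univ a)) h
      · rw [hN a a' hab]
        simp
    simp only [dotProduct, mulVec, Finset.mul_sum]
    calc ∑ a, ∑ a', y a * (N a a' * y a')
        = ∑ a, ∑ a', ∑ b ∈ (Finset.univ : Finset o).image blk, z b a * (N a a' * z b a') :=
          Finset.sum_congr rfl fun a _ => Finset.sum_congr rfl fun a' _ => hterm a a'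
      _ = ∑ a, ∑ b ∈ (Finset.univ : Finset o).image blk, ∑ a', z b a * (N a a' * z b a') :=
          Finset.sum_congr rfl fun a _ => Finset.sum_comm
      _ = ∑ b ∈ (Finset.univ : Finset o).image blk, ∑ a, ∑ a', z b a * (N a a' * z b a') :=
          Finset.sum_comm
  -- every restriction is annihilated by every constraint
  have hzc : ∀ b j, c j ⬝ᵥ z b = 0 := by
    intro b j
    obtain ⟨b', hb'⟩ := hc j
    by_cases hbb : b' = b
    · subst hbb
      rw [← hy j]
      simp only [dotProduct, hz]
      refine Finset.sum_congr rfl fun a _ => ?_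
      by_cases ha : blk a = b'
      · simp [ha]
      · rw [hb' a ha]; simp
    · simp only [dotProduct, hz]
      refine Finset.sum_eq_zero fun a _ => ?_
      by_cases ha : blk a = b
      · have : blk a ≠ b' := by rw [ha]; exact Ne.symm hbb
        rw [hb' a this, zero_mul]
      · simp [ha]
  rw [hsplit M hM, hsplit G hG, Finset.mul_sum]
  exact Finset.sum_le_sum fun b _ => hblk b (z b) (hzsupp b) (hzc b)

/-! ### The glue: from the real frame certificate to the complement-gap hypothesis -/

/-- **Complement gap from a real frame certificate.** Let `A` be any matrix on `ι → ℂ` (the Hamiltonian),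
`K` a subspace (the sector) contained in the column span of a frame `Φ` whose Gram matrix `Φᴴ Φ = G` and
compression `Φᴴ A Φ = M` are REAL, let `φ_1 … φ_k` be vectors (the certified approximate ground
multiplet) with REAL coordinate constraint vectors `c_j = Φᴴ φ_j`, and suppose the real certificate
`β yᵀ G y ≤ yᵀ M y for all real y with c_j ⬝ y = 0 ∀ j` (from `form_ge_on_ker_of_blocks` /
`form_ge_on_ker_of_rank_modified`). Then `β ‖v‖² ≤ Re ⟨v, A v⟩` for every `v ∈ K` orthogonal to all
`φ_j` — the `complement` hypothesis of a multiplet ground-state enclosure, with no loss.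
(Frame compression `⟨Φy, AΦy⟩ = yᴴ M y`; real/imaginary split, Horn–Johnson (2013) Thm 4.1.10.)
[cite: HornJohnson2013, Thm 4.1.10] -/
theorem re_form_ge_on_orthogonal_of_real_frame_certificate (A : Matrix ι ι ℂ)
    (K : Submodule ℂ (ι → ℂ)) (Φ : Matrix ι κ ℂ) (hK : ∀ v ∈ K, ∃ y : κ → ℂ, Φ *ᵥ y = v)
    (M G : Matrix κ κ ℝ) (hM : Φᴴ * A * Φ = M.map ((↑) : ℝ → ℂ))
    (hG : Φᴴ * Φ = G.map ((↑) : ℝ → ℂ)) {k : ℕ} (φ : Fin k → ι → ℂ) (c : Fin k → κ → ℝ)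
    (hc : ∀ j, Φᴴ *ᵥ φ j = fun a => (c j a : ℂ)) {β : ℝ}
    (hcert : ∀ y : κ → ℝ, (∀ j, c j ⬝ᵥ y = 0) → β * (y ⬝ᵥ G *ᵥ y) ≤ y ⬝ᵥ M *ᵥ y)
    (v : ι → ℂ) (hv : v ∈ K) (horth : ∀ j, star (φ j) ⬝ᵥ v = 0) :
    β * (star v ⬝ᵥ v).re ≤ (star v ⬝ᵥ A *ᵥ v).re := by
  obtain ⟨y, rfl⟩ := hK v hv
  have hyc : ∀ j, c j ⬝ᵥ (fun a => (y a).re) = 0 ∧ c j ⬝ᵥ (fun a => (y a).im) = 0 := fun j =>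
    dotProduct_re_im_eq_zero_of_real (c j) y (by rw [← hc j, ← star_dotProduct_frame_mulVec]; exact horth j)
  rw [frame_form Φ A y, frame_norm Φ y, hM, hG, re_star_dotProduct_map_mulVec,
    re_star_dotProduct_map_mulVec, mul_add]
  exact add_le_add (hcert _ fun j => (hyc j).1) (hcert _ fun j => (hyc j).2)

/-- Unit-vector form (`‖v‖ = 1 ⇒ β ≤ Re ⟨v, A v⟩`), literally the `complement` field of a multiplet
certificate. [cite: HornJohnson2013, Thm 4.1.10] -/
theorem re_form_ge_on_orthogonal_of_real_frame_certificate_unit (A : Matrix ι ι ℂ)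
    (K : Submodule ℂ (ι → ℂ)) (Φ : Matrix ι κ ℂ) (hK : ∀ v ∈ K, ∃ y : κ → ℂ, Φ *ᵥ y = v)
    (M G : Matrix κ κ ℝ) (hM : Φᴴ * A * Φ = M.map ((↑) : ℝ → ℂ))
    (hG : Φᴴ * Φ = G.map ((↑) : ℝ → ℂ)) {k : ℕ} (φ : Fin k → ι → ℂ) (c : Fin k → κ → ℝ)
    (hc : ∀ j, Φᴴ *ᵥ φ j = fun a => (c j a : ℂ)) {β : ℝ}
    (hcert : ∀ y : κ → ℝ, (∀ j, c j ⬝ᵥ y = 0) → β * (y ⬝ᵥ G *ᵥ y) ≤ y ⬝ᵥ M *ᵥ y)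
    (v : ι → ℂ) (hv : v ∈ K) (horth : ∀ j, star (φ j) ⬝ᵥ v = 0) (h1 : star v ⬝ᵥ v = 1) :
    β ≤ (star v ⬝ᵥ A *ᵥ v).re := by
  have h := re_form_ge_on_orthogonal_of_real_frame_certificate A K Φ hK M G hM hG φ c hc hcert v hv
    horth
  rw [h1, Complex.one_re, mul_one] at h
  exact h

end TempleKato

end Literature.MathematicalPhysics.QuantumLattice
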